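import Summits.QuantumFields.BalabanUV.T4Continuum.Support.VariationalColourTaxiTowerMerge

/-!
# T⁴ programme, spine node NE2 (U1a), lane P2 — «V-COL-TAXI-TOWER», part 4: THE STEP OF INVARIANT (E) — composing level-`k` carriers that are `γ`-close to the
# product line transports of the STRAIGHT taxi with Bałaban's one-step carriers gives level-`k+1` carriers `(γ + ((d−1)+d²)·L(n−1)(L−1)·a)`-close to the product line
# transports of the straight taxi one level up; hence (E_k) along the tower with k-UNIFORM `γ′_k` under the scale-invariant plaquette class

NE2 formalisation swarm `b2b-balaban-t4-ne2-formalise-*`, leaf prover 04 GEN 4 (`prover-b2b-balaban-t4-ne2-formalise-leaf-04-g4-0`); register row «P2-sup» of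
`t4/formal/NE2/LEAVES.md`; journal CLAIMS.log «V-COL-TAXI-TOWER».  On top of parts 1–3 (`nestLv`, `piTv_Rtrv_of_sites`, `piTv_coarseTv_eq`, `run_mul_taxiAcc_sub_le_d`,
`mergedAcc`, `outer_mul_inner_sub_mergedAcc_le`) and leaf-03-g4's `compL_J` (V-COMP-L) BY NAME.
 * §1 `J_below` (digits below `i` commute with `J`), **`mergedAcc_eq_taxiAcc`**: the merged taxi IS the straight taxi of the composite torus read through `sites`
   (`mergedAcc S y j₂ j₁ i = taxiAcc (n·L) M (Rtrv S) y (J j₂ j₁) i`), `run_eq_piTv_Rtrv` (the run of `L t₂ + t₁` fine bonds from `bpt (n·y+j₂) j₁` IS the composite run of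
   `U = ⟨t₁ + L t₂⟩` bonds from `bpt y (J j₂ j₁)`);
 * §2 **`compL_sub_lineT_taxi_le`** (THE STEP): `‖T − lineT n M (taxiTv n M C) C‖ ≤ γ` with `C := coarseTv S`, `‖T‖ ≤ 1`, `‖S‖ ≤ 1`, plaquette defect `a` ⟹
   `‖compL T (lineT (taxiTv S) S) y J U μ − lineT (n·L) M (taxiTv (n·L) M (Rtrv S)) (Rtrv S) y J U μ‖ ≤ γ + ((d−1) + d·d)·L(n−1)(L−1)·a`;
 * §3 **`nestLv_sub_lineT_le`** ((E_k) ALONG A COHERENT TOWER): `‖nestLv k y j t μ − lineT (L^k) M (taxiTv (L^k) M (Rlev k)) (Rlev k) y j t μ‖ ≤ Σ_{q<k} ((d−1)+d²)·L(L^q−1)(L−1)·a_q`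
   — with `a_q ≤ c∕(L^{q+1})²` the sum is `≤ 2d²·c·Σ_q L^{−q} ≤ 4d²c`, k-UNIFORM.  With (E_k) every level-`k` binder of the vector END at Bałaban's taxi data is a one-step
   lemma of «V-COL-TAXI» ∕ «V-UB-F» at `(n, M) := (L^k, M)`, `R := Rlev k`, frames the straight taxi `taxiTv (L^k) M (Rlev k)`.
WHAT IS NOT HERE (stated, not hidden): the instantiation of `hUBc` ∕ `hPc` themselves (a corollary file), the END.

HONEST FRAMING (T4-DAG p. 1).  Ordered-product bookkeeping at MODEL level (bond operators DATA; taxi ∕ straight contours OURS; SHAPES only, no B0, c5); [folklore];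
nothing printed is a hypothesis; no `def`, no `def … : Prop`, no `sorry`; axioms standard.  NE2 NOT proved on either road; NE3 OPEN; spine PROVED 0∕9 unchanged; rung (B)+1
finite T⁴ — NOT infinite volume, NOT mass gap, NOT Clay.  HONEST DEPENDENCY (cell, verbatim): continuum YM on T⁴ ⇐ BetaPertH ∧ nine spine estimates (0/9 proved);
BetaPertH ⇐ (D1) ∧ (D4) ∧ CAP+tail; G-an2-4 gates asym, D1 and NE2/3/4.
-/

noncomputable section

namespace Summit.QuantumFields.BalabanUV.T4Continuum.VariationalColourTaxiTransport

open Literature.MathematicalPhysics.QuantumFieldTheory.Balaban1983to89.B5Prop11Plancherel (Tor fine unitVec)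
open Literature.MathematicalPhysics.QuantumFieldTheory.Balaban1983to89.B5Block118 (tstep tstep_zero bpt)
open Literature.MathematicalPhysics.QuantumFieldTheory.Balaban1983to89.B5Composition116 (sites J JEquiv JEquiv_apply bpt_bpt_tstep J_val)
open Summit.QuantumFields.BalabanUV.T4Continuum.VariationalTaxiTransport (below corner corner_d)
open Summit.QuantumFields.BalabanUV.T4Continuum.VariationalColourFederbush (piTv norm_piTv_le_one)
open Summit.QuantumFields.BalabanUV.T4Continuum.VariationalColourTower (Rtrv)
open Summit.QuantumFields.BalabanUV.T4Continuum.VariationalVectorFederbush (lineT norm_lineT_le_one)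
open Summit.QuantumFields.BalabanUV.T4Continuum.VectorBlockTrialForm (compL compL_J val_finProdFinEquiv)

variable {d : ℕ} {E : Type*} [NormedAddCommGroup E] [NormedSpace ℂ E]
variable (L n : ℕ) [NeZero L] [NeZero n] (M : Fin d → ℕ) [hM : ∀ μ, NeZero (M μ)]

/-! ## §1 The merged taxi and the long run read on the composite torus -/

omit hM in
/-- digits below `i` commute with the digit pairing `J`. [folklore] -/
theorem J_below (j₂ : Fin d → Fin n) (j₁ : Fin d → Fin L) (i : ℕ) : J n L (below n j₂ i) (below L j₁ i) = below (n * L) (J n L j₂ j₁) i := by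
  funext ν
  by_cases h : (ν : ℕ) < i
  · simp [below, J, h]
  · simp only [below, J, h, if_false]
    exact Fin.ext (by simp [finProdFinEquiv])

variable (S : Tor (fine L (fine n M)) → Fin d → (E →L[ℂ] E))

/-- the points of the merged leg `i` correspond under `sites` to the points of the composite corner leg. [folklore] -/
theorem sites_corner_tstep (y : Tor M) (j₂ : Fin d → Fin n) (j₁ : Fin d → Fin L) (i : ℕ) (μ : Fin d) (u : ℕ) :
    sites n L M (corner (n * L) M y (J n L j₂ j₁) i + tstep (fine (n * L) M) μ u)
      = bpt L (fine n M) (corner n M y j₂ i) (below L j₁ i) + tstep (fine L (fine n M)) μ u := by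
  have h := bpt_bpt_tstep n L M y (below n j₂ i) (below L j₁ i) μ 0 u
  rw [tstep_zero, add_zero, Nat.mul_zero, Nat.add_zero, J_below] at h
  exact h.symm

/-- **THE MERGED TAXI IS THE STRAIGHT TAXI OF THE COMPOSITE TORUS**: `mergedAcc S y j₂ j₁ i = taxiAcc (n·L) M (Rtrv S) y (J j₂ j₁) i`. [folklore] -/
theorem mergedAcc_eq_taxiAcc (y : Tor M) (j₂ : Fin d → Fin n) (j₁ : Fin d → Fin L) :
    ∀ i : ℕ, mergedAcc L n M S y j₂ j₁ i = taxiAcc (n * L) M (Rtrv n L M S) y (J n L j₂ j₁) i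
  | 0 => rfl
  | i + 1 => by
    rw [mergedAcc, taxiAcc, mergedAcc_eq_taxiAcc y j₂ j₁ i]
    congr 1
    unfold mergedLeg legTv
    split_ifs with h
    · rw [J_val, show (j₁ ⟨i, h⟩ : ℕ) + L * (j₂ ⟨i, h⟩ : ℕ) = L * (j₂ ⟨i, h⟩ : ℕ) + (j₁ ⟨i, h⟩ : ℕ) from Nat.add_comm _ _]
      exact (piTv_Rtrv_of_sites L M n S ⟨i, h⟩ (sites_corner_tstep L n M y j₂ j₁ i ⟨i, h⟩) _).symm
    · rfl

omit [NeZero L] [NeZero n] in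
/-- the long run read on the composite torus: `Π^S_{L t₂ + t₁}(bpt (n·y+j₂) j₁) = Π^{Rtrv S}_{⟨t₁ + L t₂⟩}(bpt y (J j₂ j₁))`. [folklore] -/
theorem run_eq_piTv_Rtrv (y : Tor M) (j₂ : Fin d → Fin n) (j₁ : Fin d → Fin L) (μ : Fin d) (m : ℕ) :
    piTv L (fine n M) S (bpt L (fine n M) (bpt n M y j₂) j₁) μ m = piTv (n * L) M (Rtrv n L M S) (bpt (n * L) M y (J n L j₂ j₁)) μ m := by
  refine (piTv_Rtrv_of_sites L M n S μ (fun u => ?_) m).symm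
  have h := bpt_bpt_tstep n L M y j₂ j₁ μ 0 u
  rw [tstep_zero, add_zero, Nat.mul_zero, Nat.add_zero] at h
  exact h.symm

/-! ## §2 The step of invariant (E) -/

variable {S} (hS : ∀ x μ, ‖S x μ‖ ≤ 1) {a : ℝ}
  (ha : ∀ x κ ι, ‖S x κ * S (x + unitVec (fine L (fine n M)) κ) ι - S x ι * S (x + unitVec (fine L (fine n M)) ι) κ‖ ≤ a)
include hS ha

/-- **THE STEP OF (E)**: if the level-`n` carriers `T` are `γ`-close to the product line transports of the straight taxi of the coarse bonds `C := coarseTv S`, then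
`compL T (lineT (taxiTv S) S)` is `(γ + ((d−1) + d²)·L(n−1)(L−1)·a)`-close to the product line transports of the straight taxi of the composite torus. [folklore] -/
theorem compL_sub_lineT_taxi_le {T : Tor M → (Fin d → Fin n) → Fin n → Fin d → (E →L[ℂ] E)} {γ : ℝ}
    (hT : ∀ y j t μ, ‖T y j t μ - lineT n M (taxiTv n M (coarseTv L (fine n M) S)) (coarseTv L (fine n M) S) y j t μ‖ ≤ γ)
    (y : Tor M) (Jx : Fin d → Fin (n * L)) (U : Fin (n * L)) (μ : Fin d) :
    ‖compL n L M T (lineT L (fine n M) (taxiTv L (fine n M) S) S) y Jx U μ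
        - lineT (n * L) M (taxiTv (n * L) M (Rtrv n L M S)) (Rtrv n L M S) y Jx U μ‖
      ≤ γ + ((((d - 1 : ℕ) : ℝ) + (d : ℝ) * d) * (((L : ℝ) * ((n - 1 : ℕ) : ℝ) * ((L - 1 : ℕ) : ℝ)) * a)) := by
  have ha0 : 0 ≤ a := (norm_nonneg _).trans (ha 0 μ μ)
  -- split indices
  obtain ⟨⟨j₂, j₁⟩, hJ⟩ := (JEquiv n L).surjective Jx
  obtain ⟨⟨t₂, t₁⟩, hU⟩ := finProdFinEquiv.surjective U
  rw [JEquiv_apply] at hJ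
  subst hJ; subst hU
  dsimp only
  rw [compL_J]
  -- names
  set C := coarseTv L (fine n M) S with hC
  set z₀ := bpt n M y j₂ with hz₀
  set site := z₀ + tstep (fine n M) μ (t₂ : ℕ) with hsite
  set T' := lineT L (fine n M) (taxiTv L (fine n M) S) S with hT'def
  have hT'1 : ‖T' site j₁ t₁ μ‖ ≤ 1 := norm_lineT_le_one L (fine n M) hS (norm_taxiTv_le_one L (fine n M) hS) _ _ _ _
  -- (A) replace `T` by the level-`n` product line transport
  have hA : ‖T y j₂ t₂ μ * T' site j₁ t₁ μ - lineT n M (taxiTv n M C) C y j₂ t₂ μ * T' site j₁ t₁ μ‖ ≤ γ := by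
    rw [← sub_mul]
    exact (norm_mul_le _ _).trans ((mul_le_mul (hT y j₂ t₂ μ) hT'1 (norm_nonneg _) ((norm_nonneg _).trans (hT y j₂ t₂ μ))).trans_eq (mul_one _))
  -- the pieces in fine-run letters
  have hline : lineT n M (taxiTv n M C) C y j₂ t₂ μ
      = taxiAcc n M C y j₂ d * piTv L (fine n M) S (bpt L (fine n M) z₀ 0) μ (L * (t₂ : ℕ)) := by
    simp only [lineT, taxiTv_bpt, hC, piTv_coarseTv_eq, hz₀]
  have hT'site : T' site j₁ t₁ μ = taxiAcc L (fine n M) S site j₁ d * piTv L (fine n M) S (bpt L (fine n M) site j₁) μ (t₁ : ℕ) := by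
    simp only [hT'def, lineT, taxiTv_bpt]
  -- (B) the run past the inner taxi
  have hB := run_mul_taxiAcc_sub_le_d L (fine n M) hS ha z₀ j₁ μ (t₂ : ℕ)
  -- (C) the merge
  have hCm := outer_mul_inner_sub_mergedAcc_le L n M hS ha y j₂ j₁
  -- (D) the runs concatenate and are the composite run; the merged taxi is the composite taxi
  have hsite_bpt : bpt L (fine n M) site j₁ = bpt L (fine n M) z₀ j₁ + tstep (fine L (fine n M)) μ (L * (t₂ : ℕ)) := by
    rw [hsite, bpt_add_tstep_mul]
  have hD : piTv L (fine n M) S (bpt L (fine n M) z₀ j₁) μ (L * (t₂ : ℕ)) * piTv L (fine n M) S (bpt L (fine n M) site j₁) μ (t₁ : ℕ)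
      = piTv (n * L) M (Rtrv n L M S) (bpt (n * L) M y (J n L j₂ j₁)) μ ((finProdFinEquiv (t₂, t₁) : Fin (n * L)) : ℕ) := by
    rw [hsite_bpt, ← piTv_add, val_finProdFinEquiv, hz₀, run_eq_piTv_Rtrv, Nat.add_comm]
  have htarget : lineT (n * L) M (taxiTv (n * L) M (Rtrv n L M S)) (Rtrv n L M S) y (J n L j₂ j₁) (finProdFinEquiv (t₂, t₁)) μ
      = mergedAcc L n M S y j₂ j₁ d * (piTv L (fine n M) S (bpt L (fine n M) z₀ j₁) μ (L * (t₂ : ℕ)) * piTv L (fine n M) S (bpt L (fine n M) site j₁) μ (t₁ : ℕ)) := by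
    rw [hD, mergedAcc_eq_taxiAcc, lineT, taxiTv_bpt]
  -- algebra
  have e : lineT n M (taxiTv n M C) C y j₂ t₂ μ * T' site j₁ t₁ μ
        - lineT (n * L) M (taxiTv (n * L) M (Rtrv n L M S)) (Rtrv n L M S) y (J n L j₂ j₁) (finProdFinEquiv (t₂, t₁)) μ
      = taxiAcc n M C y j₂ d
          * (piTv L (fine n M) S (bpt L (fine n M) z₀ 0) μ (L * (t₂ : ℕ)) * taxiAcc L (fine n M) S site j₁ d
              - taxiAcc L (fine n M) S z₀ j₁ d * piTv L (fine n M) S (bpt L (fine n M) z₀ j₁) μ (L * (t₂ : ℕ)))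
          * piTv L (fine n M) S (bpt L (fine n M) site j₁) μ (t₁ : ℕ)
        + (taxiAcc n M C y j₂ d * taxiAcc L (fine n M) S z₀ j₁ d - mergedAcc L n M S y j₂ j₁ d)
          * (piTv L (fine n M) S (bpt L (fine n M) z₀ j₁) μ (L * (t₂ : ℕ)) * piTv L (fine n M) S (bpt L (fine n M) site j₁) μ (t₁ : ℕ)) := by
    rw [hline, hT'site, htarget]
    simp only [mul_sub, sub_mul, mul_assoc]; abel
  have hC1 : ∀ x ν, ‖C x ν‖ ≤ 1 := norm_coarseTv_le_one L (fine n M) hS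
  have hout1 : ‖taxiAcc n M C y j₂ d‖ ≤ 1 := norm_taxiAcc_le_one n M hC1 y j₂ d
  have hrun1 : ‖piTv L (fine n M) S (bpt L (fine n M) site j₁) μ (t₁ : ℕ)‖ ≤ 1 := norm_piTv_le_one L (fine n M) hS _ _ _
  have hruns1 : ‖piTv L (fine n M) S (bpt L (fine n M) z₀ j₁) μ (L * (t₂ : ℕ)) * piTv L (fine n M) S (bpt L (fine n M) site j₁) μ (t₁ : ℕ)‖ ≤ 1 := by
    have h1 := norm_piTv_le_one L (fine n M) hS (bpt L (fine n M) z₀ j₁) μ (L * (t₂ : ℕ))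
    have h3 := norm_nonneg (piTv L (fine n M) S (bpt L (fine n M) site j₁) μ (t₁ : ℕ))
    exact (norm_mul_le _ _).trans (by nlinarith)
  have ht₂ : ((t₂ : ℕ) : ℝ) ≤ ((n - 1 : ℕ) : ℝ) := by exact_mod_cast Nat.le_sub_one_of_lt t₂.is_lt
  have hK0 : 0 ≤ ((L : ℝ) * ((n - 1 : ℕ) : ℝ) * ((L - 1 : ℕ) : ℝ)) * a := by positivity
  calc ‖T y j₂ t₂ μ * T' site j₁ t₁ μ
          - lineT (n * L) M (taxiTv (n * L) M (Rtrv n L M S)) (Rtrv n L M S) y (J n L j₂ j₁) (finProdFinEquiv (t₂, t₁)) μ‖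
        ≤ ‖T y j₂ t₂ μ * T' site j₁ t₁ μ - lineT n M (taxiTv n M C) C y j₂ t₂ μ * T' site j₁ t₁ μ‖
          + ‖lineT n M (taxiTv n M C) C y j₂ t₂ μ * T' site j₁ t₁ μ
              - lineT (n * L) M (taxiTv (n * L) M (Rtrv n L M S)) (Rtrv n L M S) y (J n L j₂ j₁) (finProdFinEquiv (t₂, t₁)) μ‖ := norm_sub_le_norm_sub_add_norm_sub _ _ _
    _ ≤ γ + (1 * (((d - 1 : ℕ) : ℝ) * (((L : ℝ) * (t₂ : ℕ)) * ((L - 1 : ℕ) : ℝ) * a)) * 1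
          + (d : ℝ) * ((d : ℝ) * (((L : ℝ) * ((n - 1 : ℕ) : ℝ) * ((L - 1 : ℕ) : ℝ)) * a)) * 1) := by
          refine add_le_add hA ?_
          rw [e]
          refine (norm_add_le _ _).trans (add_le_add ?_ ?_)
          · refine (norm_mul_le _ _).trans (mul_le_mul ((norm_mul_le _ _).trans (mul_le_mul hout1 hB (norm_nonneg _) zero_le_one)) hrun1
              (norm_nonneg _) (by positivity))
          · exact (norm_mul_le _ _).trans (mul_le_mul hCm hruns1 (norm_nonneg _) (by positivity))
    _ ≤ γ + ((((d - 1 : ℕ) : ℝ) + (d : ℝ) * d) * (((L : ℝ) * ((n - 1 : ℕ) : ℝ) * ((L - 1 : ℕ) : ℝ)) * a)) := by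
          have h1 : ((d - 1 : ℕ) : ℝ) * (((L : ℝ) * (t₂ : ℕ)) * ((L - 1 : ℕ) : ℝ) * a) ≤ ((d - 1 : ℕ) : ℝ) * (((L : ℝ) * ((n - 1 : ℕ) : ℝ) * ((L - 1 : ℕ) : ℝ)) * a) := by
            apply mul_le_mul_of_nonneg_left _ (Nat.cast_nonneg _)
            have : (0 : ℝ) ≤ (L : ℝ) * ((L - 1 : ℕ) : ℝ) * a := by positivity
            nlinarith
          nlinarith

/-! ## §3 Invariant (E) along a coherent tower -/

omit hS ha in
/-- **(E_k) ALONG A COHERENT TOWER**: the nested product line transports ARE the level-`k` product line transports of the STRAIGHT level-`k` taxi up to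
`Σ_{q<k} ((d−1)+d²)·L(L^q−1)(L−1)·a_q` — k-UNIFORMLY `O(d²c)` under the scale-invariant plaquette class `(L^{q+1})²·a_q ≤ c`. [folklore] -/
theorem nestLv_sub_lineT_le {R' : (k : ℕ) → Tor (fine L (fine (L ^ k) M)) → Fin d → (E →L[ℂ] E)} (hR' : ∀ k x μ, ‖R' k x μ‖ ≤ 1) {b : ℕ → ℝ}
    (hb : ∀ k x κ ι, ‖R' k x κ * R' k (x + unitVec (fine L (fine (L ^ k) M)) κ) ι - R' k x ι * R' k (x + unitVec (fine L (fine (L ^ k) M)) ι) κ‖ ≤ b k)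
    (hcoh : ∀ k, coarseTv L (fine (L ^ (k + 1)) M) (R' (k + 1)) = Rtrv (L ^ k) L M (R' k)) :
    ∀ (k : ℕ) (y : Tor M) (j : Fin d → Fin (L ^ k)) (t : Fin (L ^ k)) (μ : Fin d),
      ‖nestLv L M R' k y j t μ - lineT (L ^ k) M (taxiTv (L ^ k) M (Rlev L M R' k)) (Rlev L M R' k) y j t μ‖
        ≤ ∑ q ∈ Finset.range k, ((((d - 1 : ℕ) : ℝ) + (d : ℝ) * d) * (((L : ℝ) * ((L ^ q - 1 : ℕ) : ℝ) * ((L - 1 : ℕ) : ℝ)) * b q))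
  | 0, y, j, t, μ => by
    have h1 : L ^ 0 = 1 := pow_zero L
    have ht : (t : ℕ) = 0 := by have := t.is_lt; omega
    have hj : j = 0 := by
      funext ν; refine Fin.ext ?_; have := (j ν).is_lt; rw [Pi.zero_apply, Fin.val_zero]; omega
    rw [hj, Finset.sum_range_zero]
    show ‖(1 : E →L[ℂ] E) - taxiTv (L ^ 0) M (Rlev L M R' 0) (bpt (L ^ 0) M y 0) * piTv (L ^ 0) M (Rlev L M R' 0) (bpt (L ^ 0) M y 0) μ (t : ℕ)‖ ≤ 0
    rw [ht, taxiTv_base]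
    simp [piTv]
  | k + 1, y, j, t, μ => by
    rw [Finset.sum_range_succ]
    have ih : ∀ y' j' t' μ', ‖nestLv L M R' k y' j' t' μ'
        - lineT (L ^ k) M (taxiTv (L ^ k) M (coarseTv L (fine (L ^ k) M) (R' k))) (coarseTv L (fine (L ^ k) M) (R' k)) y' j' t' μ'‖
          ≤ ∑ q ∈ Finset.range k, ((((d - 1 : ℕ) : ℝ) + (d : ℝ) * d) * (((L : ℝ) * ((L ^ q - 1 : ℕ) : ℝ) * ((L - 1 : ℕ) : ℝ)) * b q)) := by
      intro y' j' t' μ'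
      rw [coarseTv_eq_Rlev L M R' hcoh k]
      exact nestLv_sub_lineT_le hR' hb hcoh k y' j' t' μ'
    exact compL_sub_lineT_taxi_le L (L ^ k) M (hR' k) (hb k) ih y j t μ

end Summit.QuantumFields.BalabanUV.T4Continuum.VariationalColourTaxiTransport

end
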